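import Literature.Analysis.FluidPDE.PassiveScalarProofs
import HarnessLib

/-!
# Energy inequality for the passive scalar, II: the mollified energy identity with datum

Analysis/FluidPDE proof-support file, second of three serving the discharge of
`Literature.Analysis.FluidPDE.Torus.IsWeakScalarTransportOn.energy_ineq` / `.eScalarDissipation_le_variance`
(`FluidPDE/PassiveScalar`; Bonicatto–Ciampa–Crippa 2023, Thm. 3.3; DEIJ 2022, (1.2)).
It is the single-solution-with-datum counterpart of the zero-datum machinery of
`PassiveScalarProofs` (which treats the *difference* of two solutions): for a weak solution
`θ ∈ L^∞(0,T; L²(T^d))` of `∂ₜθ + u·∇θ = κΔθ` with datum `θ₀` and a smooth kernel `k`, writing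
`A(t, x) = (θ(t) ⋆ k)(x)` and `G(s, x) = ∫ θ(s,y) (-⟪u(s,y), ∇k(x-y)⟫ + κ Δk(x-y)) dy`,

* testing the weak formulation with `η(t) k(x₀ - ·)` gives the time-distributional identity
  `∫_{(0,T)} (η' A(·,x₀) + η G(·,x₀)) + η(0) (θ₀ ⋆ k)(x₀) = 0` (`setIntegral_test_molInt_eq`);
* the a.e. du Bois-Reymond lemma with datum (`Literature.Analysis.FunctionSpaces.ae_eq_add_setIntegral_of_forall_test`) and
  continuity in `x` give, for `θ₀ ∈ L¹`, a.e. `t` and *all* `x`: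
  `A(t, x) = (θ₀ ⋆ k)(x) + ∫_{(0,t]} G(s, x) ds`
  (`ae_forall_molInt_eq_datum_add_setIntegral_flux`);
* joint measurability of `A`, `G`, integrability of `A · G` on `(0,T) × T^d` and Fubini;
* **the mollified energy identity with datum**, for a.e. `t ∈ (0,T)`:
  `∫ A(t)² = ∫ (θ₀ ⋆ k)² + 2 ∫_{(0,t]} ∫ A(s,x) G(s,x) dx ds` (`ae_integral_sq_molInt_eq`),
  through the elementary `(c + ∫_{(a,b]} g)² = c² + 2 ∫_{(a,b]} g(s)(c + ∫_{(a,s]} g) ds`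
  (`Literature.Analysis.FluidPDE.sq_const_add_setIntegral_eq`).

This is the a.e.-in-time form of "multiply the equation for `u^δ = u ⋆ ρ^δ` by `u^δ` and
integrate" (Bonicatto–Ciampa–Crippa 2023, proof of Thm. 3.3, (3.1); DiPerna–Lions 1989,
§II.1), appropriate for merely measurable-in-time distributional solutions.

## Mathlib / tree search

Mathlib (this pin): `intervalIntegral.continuousOn_primitive`, `IntegrableOn.mul_continuousOn`,
`integral_integral_swap`, `Continuous.ext_on`; no du Bois-Reymond lemma (tree:
`DuBoisReymondAE`). Everything else from `PassiveScalarProofs` / `TorusConvolution`.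

## References

* P. Bonicatto, G. Ciampa, G. Crippa, J. Evol. Equ. 24 (2024), Paper No. 1 (arXiv:2306.15529),
  proof of Thm. 3.3, (3.1). Bib key `BonicattoCiampaCrippa2023`.
* R. J. DiPerna, P.-L. Lions, Invent. Math. 98 (1989), 511–547, §II.1. Bib key `DiPernaLions1989`.
* H. Brezis, *Functional Analysis, Sobolev Spaces and PDE* (2011), Lemma 8.1. Bib key `Brezis2011`.
-/

noncomputable section

open MeasureTheory TopologicalSpace Set Function Filter Topology Metric ContinuousLinearMap
open scoped ENNReal NNReal Convolution ContDiff InnerProductSpace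

namespace Literature.Analysis.FluidPDE

/-- **Chain rule for the square of datum plus primitive**:
`(c + ∫_{(a,b]} g)² = c² + 2 ∫_{(a,b]} g(s) (c + ∫_{(a,s]} g) ds` for `g` integrable on `(a, b]`
(`Literature.Analysis.FunctionSpaces.sq_setIntegral_eq_two_mul` plus linearity; the primitive is continuous, hence the product
`g · ∫_{(a,·]} g` is integrable). [folklore] -/
theorem sq_const_add_setIntegral_eq {a b c : ℝ} {g : ℝ → ℝ} (hg : IntegrableOn g (Ioc a b)) :
    (c + ∫ s in Ioc a b, g s) ^ 2 = c ^ 2 + 2 * ∫ s in Ioc a b, g s * (c + ∫ r in Ioc a s, g r) := by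
  rcases le_or_gt b a with hba | hab
  · simp [Ioc_eq_empty_of_le hba]
  have hgI : IntegrableOn g (Icc a b) :=
    (integrableOn_Icc_iff_integrableOn_Ioc (by simp)).2 hg
  have hP : ContinuousOn (fun s => ∫ r in Ioc a s, g r) (Icc a b) :=
    intervalIntegral.continuousOn_primitive hgI
  have hgP : IntegrableOn (fun s => g s * ∫ r in Ioc a s, g r) (Ioc a b) :=
    (hgI.mul_continuousOn hP isCompact_Icc).mono_set Ioc_subset_Icc_self
  have hsplit : ∫ s in Ioc a b, g s * (c + ∫ r in Ioc a s, g r) =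
      c * (∫ s in Ioc a b, g s) + ∫ s in Ioc a b, g s * ∫ r in Ioc a s, g r := by
    rw [← MeasureTheory.integral_const_mul, ← integral_add (hg.const_mul c) hgP]
    refine integral_congr_ae (Eventually.of_forall fun s => ?_)
    ring
  rw [hsplit, add_sq, FunctionSpaces.sq_setIntegral_eq_two_mul hg]
  ring

namespace Torus

variable {d : Type*} [Fintype d]

namespace IsWeakScalarTransportOn

variable {T κ : ℝ} {u : ℝ → UnitAddTorus d → EuclideanSpace ℝ d} {θ₀ : UnitAddTorus d → ℝ}
  {θ : ℝ → UnitAddTorus d → ℝ}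

/-! ## Testing a single solution with `η(t) k(x₀ - ·)` -/

/-- Integrability on `(0,T) × T^d` of `θ(t,y) k(x₀ - y)` for continuous `k`. [folklore] -/
theorem integrable_mul_comp_sub (h : IsWeakScalarTransportOn T κ u θ₀ θ) {k : UnitAddTorus d → ℝ}
    (hk : Continuous k) (x₀ : UnitAddTorus d) :
    Integrable (fun p : ℝ × UnitAddTorus d => θ p.1 p.2 * k (x₀ - p.2))
      (((volume : Measure ℝ).restrict (Ioo 0 T)).prod volume) := by
  obtain ⟨C, hC⟩ := FunctionSpaces.Torus.exists_forall_norm_le_of_continuous hk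
  refine Integrable.mul_bdd (c := C) h.integrable_uncurry
    ((hk.comp (continuous_const.sub continuous_snd)).aestronglyMeasurable) ?_
  exact Eventually.of_forall fun p => hC _

/-- Integrability on `(0,T) × T^d` of `θ(t,y) (-⟪u(t,y), ∇k(x₀ - y)⟫ + κ Δk(x₀ - y))` for smooth
`k` (the flux integrand `G`). [folklore] -/
theorem integrable_mul_flux (h : IsWeakScalarTransportOn T κ u θ₀ θ) {k : UnitAddTorus d → ℝ}
    (hk : FunctionSpaces.Torus.IsSmooth k) (x₀ : UnitAddTorus d) :
    Integrable (fun p : ℝ × UnitAddTorus d => θ p.1 p.2 *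
      (-⟪u p.1 p.2, FunctionSpaces.Torus.gradient k (x₀ - p.2)⟫_ℝ + κ * FunctionSpaces.Torus.laplacian k (x₀ - p.2)))
      (((volume : Measure ℝ).restrict (Ioo 0 T)).prod volume) := by
  obtain ⟨C₂, hC₂⟩ := FunctionSpaces.Torus.exists_forall_norm_le_of_continuous hk.gradient.continuous
  obtain ⟨C₃, hC₃⟩ := FunctionSpaces.Torus.exists_forall_norm_le_of_continuous hk.laplacian.continuous
  have hmu := h.aestronglyMeasurable_uncurry_velocity
  have hm : AEStronglyMeasurable (fun p : ℝ × UnitAddTorus d => θ p.1 p.2 *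
      (-⟪u p.1 p.2, FunctionSpaces.Torus.gradient k (x₀ - p.2)⟫_ℝ + κ * FunctionSpaces.Torus.laplacian k (x₀ - p.2)))
      (((volume : Measure ℝ).restrict (Ioo 0 T)).prod volume) := by
    refine h.aestronglyMeasurable_uncurry.mul ((hmu.inner ?_).neg.add ?_)
    · exact (hk.gradient.continuous.comp (continuous_const.sub continuous_snd)).aestronglyMeasurable
    · exact (continuous_const.mul (hk.laplacian.continuous.comp
        (continuous_const.sub continuous_snd))).aestronglyMeasurable
  refine Integrable.mono' (g := fun p : ℝ × UnitAddTorus d =>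
      C₂ * ‖‖u p.1 p.2‖ * θ p.1 p.2‖ + |κ| * C₃ * ‖uncurry θ p‖)
    ((h.integrable_norm_velocity_mul.norm.const_mul C₂).add
      (h.integrable_uncurry.norm.const_mul (|κ| * C₃))) hm ?_
  refine Eventually.of_forall fun p => ?_
  simp only [uncurry, Real.norm_eq_abs, abs_mul, abs_norm]
  have h2 : |⟪u p.1 p.2, FunctionSpaces.Torus.gradient k (x₀ - p.2)⟫_ℝ| ≤ ‖u p.1 p.2‖ * C₂ :=
    (abs_real_inner_le_norm _ _).trans (mul_le_mul_of_nonneg_left (hC₂ _) (norm_nonneg _))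
  have h3 : |κ * FunctionSpaces.Torus.laplacian k (x₀ - p.2)| ≤ |κ| * C₃ := by
    rw [abs_mul]
    exact mul_le_mul_of_nonneg_left (by simpa [Real.norm_eq_abs] using hC₃ (x₀ - p.2)) (abs_nonneg _)
  have hu0 : 0 ≤ ‖u p.1 p.2‖ := norm_nonneg _
  calc |θ p.1 p.2| * |-⟪u p.1 p.2, FunctionSpaces.Torus.gradient k (x₀ - p.2)⟫_ℝ + κ * FunctionSpaces.Torus.laplacian k (x₀ - p.2)|
      ≤ |θ p.1 p.2| * (‖u p.1 p.2‖ * C₂ + |κ| * C₃) := by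
        refine mul_le_mul_of_nonneg_left ((abs_add_le _ _).trans (add_le_add (by rwa [abs_neg]) h3))
          (abs_nonneg _)
    _ = C₂ * (‖u p.1 p.2‖ * |θ p.1 p.2|) + |κ| * C₃ * |θ p.1 p.2| := by ring

/-- **The time-distributional identity with datum, at a point.** Testing the weak formulation
with `η(t) k(x₀ - ·)`: for every `x₀` and every smooth compactly supported `η` with
`tsupport η ⊆ (-∞, T)`,
`∫_{(0,T)} (η' A(·, x₀) + η G(·, x₀)) + η(0) (θ₀ ⋆ k)(x₀) = 0`, where
`A(t, x₀) = ∫ θ(t,y) k(x₀-y) dy`, `G(t, x₀) = ∫ θ(t,y) (-⟪u(t,y), ∇k(x₀-y)⟫ + κ Δk(x₀-y)) dy`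
(the mollified equation `∂ₜ(θ ⋆ k) = -(div(uθ)) ⋆ k + κ Δ(θ ⋆ k)` in distributional form in
time; Bonicatto–Ciampa–Crippa 2023, proof of Thm. 2.7 / Thm. 3.3: "`u^δ = u ⋆ ρ^δ` solves …";
DiPerna–Lions 1989, §II.1). [folklore] -/
theorem setIntegral_test_molInt_eq (h : IsWeakScalarTransportOn T κ u θ₀ θ) {η : ℝ → ℝ}
    (hη : ContDiff ℝ ∞ η) (hηc : HasCompactSupport η) (hηT : tsupport η ⊆ Iio T)
    {k : UnitAddTorus d → ℝ} (hk : FunctionSpaces.Torus.IsSmooth k) (x₀ : UnitAddTorus d) :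
    (∫ t in Ioo 0 T, (deriv η t * ∫ y, θ t y * k (x₀ - y)) +
      η t * ∫ y, θ t y * (-⟪u t y, FunctionSpaces.Torus.gradient k (x₀ - y)⟫_ℝ + κ * FunctionSpaces.Torus.laplacian k (x₀ - y))) +
      η 0 * ∫ y, θ₀ y * k (x₀ - y) = 0 := by
  have hψ := isSpaceTimeTest_mul_comp_sub hη hηc hηT hk x₀
  have hk1 : FunctionSpaces.Torus.IsContDiff 1 k := hk.isContDiff (by simp)
  have key := h.integral_prod_weak_eq hψ
  have hI₁ := h.integrable_mul_comp_sub hk.continuous x₀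
  have hI₂ := h.integrable_mul_flux hk x₀
  have hpt : ∀ p : ℝ × UnitAddTorus d, θ p.1 p.2 *
      (FunctionSpaces.Torus.timeDeriv (fun t y => η t * k (x₀ - y)) p.1 p.2 +
        ⟪u p.1 p.2, FunctionSpaces.Torus.gradient ((fun t y => η t * k (x₀ - y)) p.1) p.2⟫_ℝ +
        κ * FunctionSpaces.Torus.laplacian ((fun t y => η t * k (x₀ - y)) p.1) p.2) =
      deriv η p.1 * (θ p.1 p.2 * k (x₀ - p.2)) +
        η p.1 * (θ p.1 p.2 *
          (-⟪u p.1 p.2, FunctionSpaces.Torus.gradient k (x₀ - p.2)⟫_ℝ + κ * FunctionSpaces.Torus.laplacian k (x₀ - p.2))) := by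
    intro p
    rw [timeDeriv_mul_comp_sub, gradient_mul_comp_sub hk1, laplacian_mul_comp_sub hk,
      inner_neg_right, real_inner_smul_right]
    ring
  have hdatum : ∫ x, θ₀ x * (fun t y => η t * k (x₀ - y)) 0 x = η 0 * ∫ y, θ₀ y * k (x₀ - y) := by
    rw [← MeasureTheory.integral_const_mul]
    refine integral_congr_ae (Eventually.of_forall fun x => ?_)
    dsimp only
    ring
  set P : Measure (ℝ × UnitAddTorus d) := ((volume : Measure ℝ).restrict (Ioo 0 T)).prod volume
    with hP
  obtain ⟨Ca, hCa⟩ := (hη.continuous_deriv (by simp)).bounded_above_of_compact_support hηc.deriv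
  obtain ⟨Cb, hCb⟩ := hη.continuous.bounded_above_of_compact_support hηc
  set f : ℝ × UnitAddTorus d → ℝ := fun p => deriv η p.1 * (θ p.1 p.2 * k (x₀ - p.2)) with hf_def
  set g : ℝ × UnitAddTorus d → ℝ := fun p => η p.1 * (θ p.1 p.2 *
    (-⟪u p.1 p.2, FunctionSpaces.Torus.gradient k (x₀ - p.2)⟫_ℝ + κ * FunctionSpaces.Torus.laplacian k (x₀ - p.2))) with hg_def
  have hf : Integrable f P :=
    hI₁.bdd_mul ((hη.continuous_deriv (by simp)).comp continuous_fst).aestronglyMeasurable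
      (Eventually.of_forall fun p => hCa p.1)
  have hg : Integrable g P :=
    hI₂.bdd_mul (hη.continuous.comp continuous_fst).aestronglyMeasurable
      (Eventually.of_forall fun p => hCb p.1)
  have esum : (∫ p, (f p + g p) ∂P) + η 0 * ∫ y, θ₀ y * k (x₀ - y) = 0 := by
    have e1 : ∫ p, (f p + g p) ∂P = ∫ p, θ p.1 p.2 *
        (FunctionSpaces.Torus.timeDeriv (fun t y => η t * k (x₀ - y)) p.1 p.2 +
          ⟪u p.1 p.2, FunctionSpaces.Torus.gradient ((fun t y => η t * k (x₀ - y)) p.1) p.2⟫_ℝ +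
          κ * FunctionSpaces.Torus.laplacian ((fun t y => η t * k (x₀ - y)) p.1) p.2) ∂P :=
      integral_congr_ae (Eventually.of_forall fun p => (hpt p).symm)
    rw [e1, ← hdatum]
    exact key
  have ef : ∫ p, f p ∂P = ∫ t in Ioo 0 T, deriv η t * ∫ y, θ t y * k (x₀ - y) := by
    rw [hP, integral_prod _ hf]
    refine integral_congr_ae (Eventually.of_forall fun t => ?_)
    simp only [hf_def]
    exact MeasureTheory.integral_const_mul _ _
  have eg : ∫ p, g p ∂P = ∫ t in Ioo 0 T, η t * ∫ y, θ t y *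
      (-⟪u t y, FunctionSpaces.Torus.gradient k (x₀ - y)⟫_ℝ + κ * FunctionSpaces.Torus.laplacian k (x₀ - y)) := by
    rw [hP, integral_prod _ hg]
    refine integral_congr_ae (Eventually.of_forall fun t => ?_)
    simp only [hg_def]
    exact MeasureTheory.integral_const_mul _ _
  have ha : Integrable (fun t => deriv η t * ∫ y, θ t y * k (x₀ - y)) (volume.restrict (Ioo 0 T)) := by
    have := hf.integral_prod_left
    refine this.congr (Eventually.of_forall fun t => ?_)
    simp only [hf_def]
    exact MeasureTheory.integral_const_mul _ _
  have hb : Integrable (fun t => η t * ∫ y, θ t y *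
      (-⟪u t y, FunctionSpaces.Torus.gradient k (x₀ - y)⟫_ℝ + κ * FunctionSpaces.Torus.laplacian k (x₀ - y)))
      (volume.restrict (Ioo 0 T)) := by
    have := hg.integral_prod_left
    refine this.congr (Eventually.of_forall fun t => ?_)
    simp only [hg_def]
    exact MeasureTheory.integral_const_mul _ _
  rw [integral_add hf hg, ef, eg] at esum
  rw [integral_add ha hb]
  exact esum

/-! ## The time primitive with datum -/

/-- **du Bois-Reymond in time, at a point, with datum.** For every `x₀` and a.e. `t ∈ (0,T)`:
`∫ θ(t,y) k(x₀-y) dy = ∫ θ₀(y) k(x₀-y) dy + ∫_{(0,t]} G(s, x₀) ds`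
(`Literature.Analysis.FunctionSpaces.ae_eq_add_setIntegral_of_forall_test` applied to `setIntegral_test_molInt_eq`). [folklore] -/
theorem ae_molInt_eq_datum_add_setIntegral_flux (h : IsWeakScalarTransportOn T κ u θ₀ θ)
    {k : UnitAddTorus d → ℝ} (hk : FunctionSpaces.Torus.IsSmooth k) (x₀ : UnitAddTorus d) :
    ∀ᵐ t ∂(volume.restrict (Ioo 0 T)),
      ∫ y, θ t y * k (x₀ - y) = (∫ y, θ₀ y * k (x₀ - y)) +
        ∫ s in Ioc 0 t, ∫ y, θ s y *
          (-⟪u s y, FunctionSpaces.Torus.gradient k (x₀ - y)⟫_ℝ + κ * FunctionSpaces.Torus.laplacian k (x₀ - y)) := by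
  have hU : IntegrableOn (fun t => ∫ y, θ t y * k (x₀ - y)) (Ioo 0 T) volume :=
    (h.integrable_mul_comp_sub hk.continuous x₀).integral_prod_left
  have hF : IntegrableOn (fun t => ∫ y, θ t y *
      (-⟪u t y, FunctionSpaces.Torus.gradient k (x₀ - y)⟫_ℝ + κ * FunctionSpaces.Torus.laplacian k (x₀ - y))) (Ioo 0 T) volume :=
    (h.integrable_mul_flux hk x₀).integral_prod_left
  exact FunctionSpaces.ae_eq_add_setIntegral_of_forall_test hU hF fun η hη hηc hηT =>
    h.setIntegral_test_molInt_eq hη hηc hηT hk x₀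

/-- For a.e. `t ∈ (0,T)` the slice `θ t` is integrable together with `‖u t‖ θ t`, and `u t` is
a.e.-strongly measurable. [folklore] -/
theorem ae_slice_integrable₁ (h : IsWeakScalarTransportOn T κ u θ₀ θ) :
    ∀ᵐ t ∂(volume.restrict (Ioo 0 T)), Integrable (θ t) volume ∧
      AEStronglyMeasurable (u t) volume ∧ Integrable (fun y => ‖u t y‖ * θ t y) volume := by
  filter_upwards [h.ae_memLp_two, h.ae_aestronglyMeasurable_velocity_slice,
    h.ae_integrable_norm_velocity_mul] with t hm hu hi
  exact ⟨hm.integrable one_le_two, hu, hi⟩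

/-- **An integrable majorant of the flux integral of a single solution**, uniform in `x`:
there is `bound ∈ L¹(0,T)` with `‖G(s, x)‖ ≤ bound(s)` for a.e. `s` and all `x`. [folklore] -/
theorem exists_flux_bound₁ (h : IsWeakScalarTransportOn T κ u θ₀ θ) {k : UnitAddTorus d → ℝ}
    (hk : FunctionSpaces.Torus.IsSmooth k) :
    ∃ bound : ℝ → ℝ, IntegrableOn bound (Ioo 0 T) volume ∧
      ∀ᵐ s ∂(volume.restrict (Ioo 0 T)), ∀ x,
        ‖∫ y, θ s y * (-⟪u s y, FunctionSpaces.Torus.gradient k (x - y)⟫_ℝ + κ * FunctionSpaces.Torus.laplacian k (x - y))‖ ≤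
          bound s := by
  obtain ⟨C₂, hC₂⟩ := FunctionSpaces.Torus.exists_forall_norm_le_of_continuous hk.gradient.continuous
  obtain ⟨C₃, hC₃⟩ := FunctionSpaces.Torus.exists_forall_norm_le_of_continuous hk.laplacian.continuous
  set bound : ℝ → ℝ := fun s => C₂ * (∫ y, ‖u s y‖ * |θ s y|) + |κ| * C₃ * ∫ y, |θ s y| with hbound
  have hbi : IntegrableOn bound (Ioo 0 T) volume := by
    rw [IntegrableOn, hbound]
    exact (h.integrableOn_integral_norm_velocity_mul.const_mul C₂).add
      (h.integrableOn_integral_abs.const_mul (|κ| * C₃))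
  refine ⟨bound, hbi, ?_⟩
  filter_upwards [h.ae_slice_integrable₁] with s hs x
  rw [Real.norm_eq_abs]
  exact abs_fluxIntegral_le (δ := θ s) hs.1 hs.2.2 hC₂ hC₃ κ x

/-- **The time primitive with datum, simultaneously in `x`.** For integrable `θ₀`, a.e.
`t ∈ (0,T)` and *every* `x`: `∫ θ(t,y) k(x-y) dy = ∫ θ₀(y) k(x-y) dy + ∫_{(0,t]} G(s, x) ds`
(the identity holds on a countable dense set of `x`, and the three terms are continuous in `x`:
two mollifications of integrable slices and a parametric integral with an integrable majorant). [folklore] -/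
theorem ae_forall_molInt_eq_datum_add_setIntegral_flux (h : IsWeakScalarTransportOn T κ u θ₀ θ)
    (hθ₀ : Integrable θ₀ volume) {k : UnitAddTorus d → ℝ} (hk : FunctionSpaces.Torus.IsSmooth k) :
    ∀ᵐ t ∂(volume.restrict (Ioo 0 T)), ∀ x : UnitAddTorus d,
      ∫ y, θ t y * k (x - y) = (∫ y, θ₀ y * k (x - y)) +
        ∫ s in Ioc 0 t, ∫ y, θ s y *
          (-⟪u s y, FunctionSpaces.Torus.gradient k (x - y)⟫_ℝ + κ * FunctionSpaces.Torus.laplacian k (x - y)) := by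
  obtain ⟨D, hDc, hDd⟩ := TopologicalSpace.exists_countable_dense (UnitAddTorus d)
  haveI : Countable D := hDc.to_subtype
  have hD : ∀ᵐ t ∂(volume.restrict (Ioo 0 T)), ∀ x : D,
      ∫ y, θ t y * k ((x : UnitAddTorus d) - y) = (∫ y, θ₀ y * k ((x : UnitAddTorus d) - y)) +
        ∫ s in Ioc 0 t, ∫ y, θ s y *
          (-⟪u s y, FunctionSpaces.Torus.gradient k ((x : UnitAddTorus d) - y)⟫_ℝ +
            κ * FunctionSpaces.Torus.laplacian k ((x : UnitAddTorus d) - y)) :=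
    ae_all_iff.2 fun x => h.ae_molInt_eq_datum_add_setIntegral_flux hk x
  obtain ⟨bound, hbi, hGb⟩ := h.exists_flux_bound₁ hk
  filter_upwards [hD, h.ae_slice_integrable₁, ae_restrict_mem measurableSet_Ioo] with t ht hs htT
  have hconv : ∀ {δ : UnitAddTorus d → ℝ}, Integrable δ volume →
      Continuous fun x => ∫ y, δ y * k (x - y) := by
    intro δ hδ
    have e : (fun x => ∫ y, δ y * k (x - y)) = δ ⋆ k := by
      funext x
      simp only [convolution_lsmul, smul_eq_mul]
    rw [e]
    exact FunctionSpaces.Torus.continuous_convolution hδ hk.continuous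
  have hcl : Continuous fun x => ∫ y, θ t y * k (x - y) := hconv hs.1
  have hsub : Ioc 0 t ⊆ Ioo 0 T := Ioc_subset_Ioo_right htT.2
  have hcr : Continuous fun x => (∫ y, θ₀ y * k (x - y)) + ∫ s in Ioc 0 t, ∫ y, θ s y *
      (-⟪u s y, FunctionSpaces.Torus.gradient k (x - y)⟫_ℝ + κ * FunctionSpaces.Torus.laplacian k (x - y)) := by
    refine (hconv hθ₀).add ?_
    refine continuous_of_dominated (bound := bound) (fun x => ?_) (fun x => ?_) (hbi.mono_set hsub) ?_
    · have hGi : IntegrableOn (fun s => ∫ y, θ s y *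
          (-⟪u s y, FunctionSpaces.Torus.gradient k (x - y)⟫_ℝ + κ * FunctionSpaces.Torus.laplacian k (x - y))) (Ioo 0 T) volume :=
        (h.integrable_mul_flux hk x).integral_prod_left
      exact (hGi.mono_set hsub).aestronglyMeasurable
    · exact ae_restrict_of_ae_restrict_of_subset hsub (hGb.mono fun s hs => hs x)
    · refine ae_restrict_of_ae_restrict_of_subset hsub ?_
      filter_upwards [h.ae_slice_integrable₁] with s hs
      exact continuous_fluxIntegral (δ := θ s) hs.1 hs.2.1 hs.2.2 hk κ
  exact congrFun (Continuous.ext_on hDd hcl hcr fun x hx => ht ⟨x, hx⟩)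

/-! ## Joint measurability and Fubini for `A · G` -/

/-- Joint measurability of the mollified solution `A(s, x) = ∫ θ(s,y) k(x-y) dy`. [folklore] -/
theorem aestronglyMeasurable_uncurry_molInt₁ (h : IsWeakScalarTransportOn T κ u θ₀ θ)
    {k : UnitAddTorus d → ℝ} (hk : Continuous k) :
    AEStronglyMeasurable (uncurry fun s x => ∫ y, θ s y * k (x - y))
      (((volume : Measure ℝ).restrict (Ioo 0 T)).prod volume) := by
  have e : (uncurry fun s x => ∫ y, θ s y * k (x - y)) = uncurry fun s x => ((θ s) ⋆[lsmul ℝ ℝ] k) x := by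
    funext p
    simp only [uncurry, convolution_lsmul, smul_eq_mul]
  rw [e]
  exact FunctionSpaces.Torus.aestronglyMeasurable_uncurry_convolution (lsmul ℝ ℝ) h.aestronglyMeasurable_uncurry hk

/-- Joint measurability of the flux integral `G(s, x)` of a single solution. [folklore] -/
theorem aestronglyMeasurable_uncurry_flux₁ (h : IsWeakScalarTransportOn T κ u θ₀ θ)
    {k : UnitAddTorus d → ℝ} (hk : FunctionSpaces.Torus.IsSmooth k) :
    AEStronglyMeasurable (uncurry fun s x => ∫ y, θ s y *
      (-⟪u s y, FunctionSpaces.Torus.gradient k (x - y)⟫_ℝ + κ * FunctionSpaces.Torus.laplacian k (x - y)))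
      (((volume : Measure ℝ).restrict (Ioo 0 T)).prod volume) := by
  set Ψ : (ℝ × UnitAddTorus d) × UnitAddTorus d → ℝ := fun q => θ q.1.1 q.2 *
    (-⟪u q.1.1 q.2, FunctionSpaces.Torus.gradient k (q.1.2 - q.2)⟫_ℝ + κ * FunctionSpaces.Torus.laplacian k (q.1.2 - q.2)) with hΨ
  have hsub : AEStronglyMeasurable (fun q : (ℝ × UnitAddTorus d) × UnitAddTorus d => q.1.2 - q.2)
      ((((volume : Measure ℝ).restrict (Ioo 0 T)).prod volume).prod volume) :=
    (measurable_fst.snd.sub measurable_snd).aestronglyMeasurable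
  have hΨm : AEStronglyMeasurable Ψ ((((volume : Measure ℝ).restrict (Ioo 0 T)).prod volume).prod volume) := by
    refine (FunctionSpaces.Torus.aestronglyMeasurable_comp_fst_snd h.aestronglyMeasurable_uncurry).mul ?_
    refine ((FunctionSpaces.Torus.aestronglyMeasurable_comp_fst_snd h.aestronglyMeasurable_uncurry_velocity).inner
      (hk.gradient.continuous.comp_aestronglyMeasurable hsub)).neg.add ?_
    exact aestronglyMeasurable_const.mul (hk.laplacian.continuous.comp_aestronglyMeasurable hsub)
  have e : (uncurry fun s x => ∫ y, θ s y *
      (-⟪u s y, FunctionSpaces.Torus.gradient k (x - y)⟫_ℝ + κ * FunctionSpaces.Torus.laplacian k (x - y))) =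
      fun p => ∫ y, Ψ (p, y) := by
    funext p
    rfl
  rw [e]
  exact hΨm.integral_prod_right'

/-- **Integrability of `A · G` on `(0,T) × T^d`**: `|G(s,x)| ≤ bound(s) ∈ L¹` and
`|A(s,x)| ≤ sup|k| · C` for a.e. `s` (the `L^∞_t L²_x ⊂ L^∞_t L¹_x` bound). [folklore] -/
theorem integrable_molInt_mul_flux (h : IsWeakScalarTransportOn T κ u θ₀ θ) {k : UnitAddTorus d → ℝ}
    (hk : FunctionSpaces.Torus.IsSmooth k) :
    Integrable (fun p : ℝ × UnitAddTorus d => (∫ y, θ p.1 y * k (p.2 - y)) *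
      ∫ y, θ p.1 y * (-⟪u p.1 y, FunctionSpaces.Torus.gradient k (p.2 - y)⟫_ℝ + κ * FunctionSpaces.Torus.laplacian k (p.2 - y)))
      (((volume : Measure ℝ).restrict (Ioo 0 T)).prod volume) := by
  set μT : Measure ℝ := (volume : Measure ℝ).restrict (Ioo 0 T) with hμT
  obtain ⟨K, hK⟩ := FunctionSpaces.Torus.exists_forall_norm_le_of_continuous hk.continuous
  obtain ⟨C, hC⟩ := h.exists_eLpNorm_le
  obtain ⟨bound, hbi, hGb⟩ := h.exists_flux_bound₁ hk
  have hK0 : 0 ≤ K := (norm_nonneg _).trans (hK 0)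
  have hAb : ∀ᵐ s ∂μT, ∀ x, ‖∫ y, θ s y * k (x - y)‖ ≤ K * C := by
    filter_upwards [h.ae_slice_integrable₁, h.ae_memLp_two, hC] with s hs hm hc x
    have hconv : (∫ y, θ s y * k (x - y)) = ((θ s) ⋆ k) x := by
      simp only [convolution_lsmul, smul_eq_mul]
    rw [hconv]
    refine (FunctionSpaces.Torus.norm_convolution_le hs.1 hK x).trans (mul_le_mul_of_nonneg_left ?_ hK0)
    have e : ∫ y, ‖θ s y‖ = ∫ y, |θ s y| := integral_congr_ae (Eventually.of_forall fun y => by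
      simp [Real.norm_eq_abs])
    rw [e]
    exact integral_abs_le_of_eLpNorm_le hm hc
  have hFm : AEStronglyMeasurable (fun p : ℝ × UnitAddTorus d => (∫ y, θ p.1 y * k (p.2 - y)) *
      ∫ y, θ p.1 y * (-⟪u p.1 y, FunctionSpaces.Torus.gradient k (p.2 - y)⟫_ℝ + κ * FunctionSpaces.Torus.laplacian k (p.2 - y)))
      (μT.prod volume) :=
    (h.aestronglyMeasurable_uncurry_molInt₁ hk.continuous).mul (h.aestronglyMeasurable_uncurry_flux₁ hk)
  have hBi : Integrable (fun p : ℝ × UnitAddTorus d => (K * C) * bound p.1 * (1 : ℝ)) (μT.prod volume) :=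
    ((hbi.const_mul (K * C)).mul_prod (integrable_const (1 : ℝ)))
  refine Integrable.mono' (hBi.congr (Eventually.of_forall fun p => mul_one _)) hFm ?_
  have hae : ∀ᵐ s ∂μT, ∀ x, ‖(∫ y, θ s y * k (x - y)) *
      ∫ y, θ s y * (-⟪u s y, FunctionSpaces.Torus.gradient k (x - y)⟫_ℝ + κ * FunctionSpaces.Torus.laplacian k (x - y))‖ ≤
        (K * C) * bound s := by
    filter_upwards [hGb, hAb] with s hG hA x
    rw [norm_mul]
    exact mul_le_mul (hA x) (hG x) (norm_nonneg _) (by positivity)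
  have := (Measure.quasiMeasurePreserving_fst (μ := μT) (ν := (volume : Measure (UnitAddTorus d)))).ae hae
  filter_upwards [this] with p hp
  exact hp p.2

/-- **Fubini for `A · G` on `(0, t] × T^d`**, `t < T`: `∫ₓ ∫_{(0,t]} A G = ∫_{(0,t]} ∫ₓ A G`. [folklore] -/
theorem integral_integral_molInt_mul_flux_swap (h : IsWeakScalarTransportOn T κ u θ₀ θ)
    {k : UnitAddTorus d → ℝ} (hk : FunctionSpaces.Torus.IsSmooth k) {t : ℝ} (ht : t ∈ Ioo 0 T) :
    ∫ x, ∫ s in Ioc 0 t, (∫ y, θ s y * k (x - y)) *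
        ∫ y, θ s y * (-⟪u s y, FunctionSpaces.Torus.gradient k (x - y)⟫_ℝ + κ * FunctionSpaces.Torus.laplacian k (x - y)) =
      ∫ s in Ioc 0 t, ∫ x, (∫ y, θ s y * k (x - y)) *
        ∫ y, θ s y * (-⟪u s y, FunctionSpaces.Torus.gradient k (x - y)⟫_ℝ + κ * FunctionSpaces.Torus.laplacian k (x - y)) := by
  have hsub : Ioc 0 t ⊆ Ioo 0 T := Ioc_subset_Ioo_right ht.2
  have hle : (volume : Measure ℝ).restrict (Ioc 0 t) ≤ (volume : Measure ℝ).restrict (Ioo 0 T) :=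
    Measure.restrict_mono_set _ hsub
  have hFi := (h.integrable_molInt_mul_flux hk).mono_measure (Measure.prod_mono hle le_rfl)
  exact integral_integral_swap (μ := (volume : Measure (UnitAddTorus d)))
    (ν := (volume : Measure ℝ).restrict (Ioc 0 t))
    (f := fun x s => (∫ y, θ s y * k (x - y)) *
      ∫ y, θ s y * (-⟪u s y, FunctionSpaces.Torus.gradient k (x - y)⟫_ℝ + κ * FunctionSpaces.Torus.laplacian k (x - y))) hFi.swap

/-- `s ↦ ∫ₓ A(s,x) G(s,x) dx` is integrable on `(0,T)`. [folklore] -/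
theorem integrableOn_integral_molInt_mul_flux (h : IsWeakScalarTransportOn T κ u θ₀ θ)
    {k : UnitAddTorus d → ℝ} (hk : FunctionSpaces.Torus.IsSmooth k) :
    IntegrableOn (fun s => ∫ x, (∫ y, θ s y * k (x - y)) *
      ∫ y, θ s y * (-⟪u s y, FunctionSpaces.Torus.gradient k (x - y)⟫_ℝ + κ * FunctionSpaces.Torus.laplacian k (x - y)))
      (Ioo 0 T) volume :=
  (h.integrable_molInt_mul_flux hk).integral_prod_left

/-- Convolution form of `integrableOn_integral_molInt_mul_flux`: `s ↦ ∫ₓ (θ(s) ⋆ k)(x) G(s,x) dx`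
is integrable on `(0,T)`. [folklore] -/
theorem integrableOn_integral_conv_mul_flux (h : IsWeakScalarTransportOn T κ u θ₀ θ)
    {k : UnitAddTorus d → ℝ} (hk : FunctionSpaces.Torus.IsSmooth k) :
    IntegrableOn (fun s => ∫ x, ((θ s) ⋆ k) x *
      ∫ y, θ s y * (-⟪u s y, FunctionSpaces.Torus.gradient k (x - y)⟫_ℝ + κ * FunctionSpaces.Torus.laplacian k (x - y)))
      (Ioo 0 T) volume := by
  have e : (fun s => ∫ x, ((θ s) ⋆ k) x *
      ∫ y, θ s y * (-⟪u s y, FunctionSpaces.Torus.gradient k (x - y)⟫_ℝ + κ * FunctionSpaces.Torus.laplacian k (x - y))) =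
      fun s => ∫ x, (∫ y, θ s y * k (x - y)) *
        ∫ y, θ s y * (-⟪u s y, FunctionSpaces.Torus.gradient k (x - y)⟫_ℝ + κ * FunctionSpaces.Torus.laplacian k (x - y)) := by
    funext s
    simp only [convolution_lsmul, smul_eq_mul]
  rw [e]
  exact h.integrableOn_integral_molInt_mul_flux hk

/-! ## The mollified energy identity with datum -/

/-- **The mollified energy identity with datum** (Bonicatto–Ciampa–Crippa 2023, proof of
Thm. 3.3, (3.1): "multiply the equation for `u^δ = u ⋆ ρ^δ` by `u^δ` and integrate"; here in
the a.e.-in-time form appropriate to merely measurable-in-time weak solutions): for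
`θ₀ ∈ L¹(T^d)`, a smooth kernel `k`, `A(t) = θ(t) ⋆ k`, and the flux
`G(s,x) = ∫ θ(s,y) (-⟪u(s,y), ∇k(x-y)⟫ + κ Δk(x-y)) dy`, for a.e. `t ∈ (0,T)`:
`∫ A(t)² = ∫ (θ₀ ⋆ k)² + 2 ∫_{(0,t]} ∫ A(s,x) G(s,x) dx ds`
(time primitive `A = θ₀ ⋆ k + ∫₀ᵗ G`, chain rule for the square of a primitive, Fubini). [cite: BonicattoCiampaCrippa2023, Thm. 3.3 proof (3.1)] -/
theorem ae_integral_sq_molInt_eq (h : IsWeakScalarTransportOn T κ u θ₀ θ)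
    (hθ₀ : Integrable θ₀ volume) {k : UnitAddTorus d → ℝ} (hk : FunctionSpaces.Torus.IsSmooth k) :
    ∀ᵐ t ∂(volume.restrict (Ioo 0 T)),
      ∫ x, ((θ t) ⋆ k) x ^ 2 = (∫ x, (θ₀ ⋆ k) x ^ 2) +
        2 * ∫ s in Ioc 0 t, ∫ x, ((θ s) ⋆ k) x *
          ∫ y, θ s y * (-⟪u s y, FunctionSpaces.Torus.gradient k (x - y)⟫_ℝ + κ * FunctionSpaces.Torus.laplacian k (x - y)) := by
  filter_upwards [h.ae_forall_molInt_eq_datum_add_setIntegral_flux hθ₀ hk,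
    ae_restrict_mem measurableSet_Ioo, h.ae_slice_integrable₁] with t hAt htT hst
  have hsub : Ioc 0 t ⊆ Ioo 0 T := Ioc_subset_Ioo_right htT.2
  have hconv : ∀ (δ : UnitAddTorus d → ℝ) (x : UnitAddTorus d), (δ ⋆ k) x = ∫ y, δ y * k (x - y) :=
    fun δ x => by simp only [convolution_lsmul, smul_eq_mul]
  simp_rw [hconv]
  -- Step 1: pointwise in `x`
  have hpt : ∀ x, (∫ y, θ t y * k (x - y)) ^ 2 = (∫ y, θ₀ y * k (x - y)) ^ 2 +
      2 * ∫ s in Ioc 0 t, (∫ y, θ s y * k (x - y)) *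
        ∫ y, θ s y * (-⟪u s y, FunctionSpaces.Torus.gradient k (x - y)⟫_ℝ + κ * FunctionSpaces.Torus.laplacian k (x - y)) := by
    intro x
    have hGx : IntegrableOn (fun s => ∫ y, θ s y *
        (-⟪u s y, FunctionSpaces.Torus.gradient k (x - y)⟫_ℝ + κ * FunctionSpaces.Torus.laplacian k (x - y))) (Ioo 0 T) volume :=
      (h.integrable_mul_flux hk x).integral_prod_left
    rw [hAt x, sq_const_add_setIntegral_eq (hGx.mono_set hsub)]
    congr 2
    refine integral_congr_ae ?_
    filter_upwards [ae_restrict_of_ae_restrict_of_subset hsub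
      (h.ae_molInt_eq_datum_add_setIntegral_flux hk x)] with s hs
    rw [hs, mul_comm]
  -- Step 2: integrate in `x` and swap
  have hA0c : Continuous fun x => ∫ y, θ₀ y * k (x - y) := by
    have e : (fun x => ∫ y, θ₀ y * k (x - y)) = θ₀ ⋆ k := funext fun x => (hconv θ₀ x).symm
    rw [e]
    exact FunctionSpaces.Torus.continuous_convolution hθ₀ hk.continuous
  have i0 : Integrable (fun x => (∫ y, θ₀ y * k (x - y)) ^ 2) volume := (hA0c.pow 2).integrable_unitAddTorus
  have hI : Integrable (fun x => ∫ s in Ioc 0 t, (∫ y, θ s y * k (x - y)) *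
      ∫ y, θ s y * (-⟪u s y, FunctionSpaces.Torus.gradient k (x - y)⟫_ℝ + κ * FunctionSpaces.Torus.laplacian k (x - y))) volume := by
    have hle : (volume : Measure ℝ).restrict (Ioc 0 t) ≤ (volume : Measure ℝ).restrict (Ioo 0 T) :=
      Measure.restrict_mono_set _ hsub
    have hFi := (h.integrable_molInt_mul_flux hk).mono_measure (Measure.prod_mono hle le_rfl)
    exact hFi.swap.integral_prod_left
  simp_rw [hpt]
  rw [integral_add i0 (hI.const_mul 2), MeasureTheory.integral_const_mul,
    h.integral_integral_molInt_mul_flux_swap hk htT]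

end IsWeakScalarTransportOn

end Torus

end Literature.Analysis.FluidPDE
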